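import Literature.NumberTheory.EllipticCurves.CofreeContinuousRepNewform
import Literature.NumberTheory.EllipticCurves.Skinner2016.HidaCongruentMembers
import Literature.NumberTheory.GaloisRepresentations.FramedRepTwist
import Literature.NumberTheory.GaloisRepresentations.AdZeroBlochKatoDatum
import HarnessLib

/-!
# The self-dual Tate twist `T_g^† = T_g ⊗ ε^{1−k/2}` of an ordinary newform datum, its discrete module
# `A_g^† = V_g^†/T_g^†` and its restriction to `Γ_K`

Topic `NumberTheory/EllipticCurves` (Iwasawa theory of newforms; cell `bsd-stepL`, seat `bsd-stepL-imc-p1` g24,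
memo `run/shared/lean/pub/bsd-stepL/imc-p1/g24/TWIST-AUDIT-25505-imc-p1-g24.md`). Definitions with bodies and
proved unfolding lemmas; no named fact, no instance, no `sorry`.

## Why this file exists

The tree's integral model of a `p`-ordinary newform `g ∈ S_k(Γ₀(M))`, `Δ : OrdinaryNewformDatum g p ι`
(`GreenbergSelmerNewformDatum`), is normalised by `Δ.charpoly`: `Δ.ρ : Γ_ℚ → GL₂(𝒪)` is unramified at `ℓ ∤ Mp`
with ARITHMETIC-Frobenius characteristic polynomial `X² − ι(a_ℓ(g))X + ℓ^{k−1}`, so `det Δ.ρ = ε^{k−1}` (`ε` the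
`p`-adic cyclotomic character) — the normalisation of the cyclotomic theory [EmertonPollackWeston2006, §3.1],
[SkinnerUrban2014]. The ANTICYCLOTOMIC theory of Bertolini–Darmon–Prasanna type at weight `k` is stated in print
for the **self-dual Tate twist**: Castella's erratum, §2 (p. 2): "Let `V_g` be the self-dual Tate twist of the
Galois representation associated to `g` by Deligne, let `T_g ⊂ V_g` be the `G_ℚ`-stable `𝒪`-lattice in
[Nek92, § 3], and put `A_g := V_g/T_g`"; Castella–Hsieh, §1 (p. 1): "`ρ_f : Gal(ℚ̄/ℚ) → Aut_F(V_f(r))` the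
self-dual Tate twist of the `p`-adic Galois representation associated to `f`" (weight `2r`), §7.1: "`T` is the
`G_ℚ`-stable `𝒪`-lattice of the self-dual Galois representation `V` as in [Nek92, §3] … a `G_ℚ`-equivariant
`𝒪`-linear perfect pairing `⟨,⟩ : T × T → 𝒪(1)`" — so `det T_g = ε`. Since `Δ.ρ ⊗ Frac(𝒪) ≅ V_g^{Del}(k−1)`
and the self-dual twist is `V_g^† = V_g^{Del}(k/2)`, the self-dual lattice is `Δ.ρ ⊗ ε^{1−k/2}`
(`det = ε^{k−1} · ε^{2−k} = ε`); for `k = 2` it is `Δ.ρ` itself (`selfDualRep_eq_of_two`). This file supplies that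
twist in the tree's vocabulary — `FramedRep.twist` (file `GaloisRepresentations/FramedRepTwist`) by the integer
power `1 − k/2` of the continuous cyclotomic character with values in `𝒪ˣ` (`cyclotomicCharacterToUnitsCont`,
file `GaloisRepresentations/AdZeroBlochKatoDatum`, through the tree's `Algebra ℤ_[p] (padicCoeffIntegers ι)` of
`Skinner2016/HidaCongruentMembers`) — together with the discrete module `A_g^† = F²/𝒪²` carrying the twisted action
(`cofreeContinuousRep`, open denominators by `hasOpenDenominators_padicCoeffIntegers`) and its restriction to
`Γ_K`, on the same footing as `Δ.cofreeRep` ∕ `Δ.cofreeRepOver K` (file `CofreeContinuousRepNewform`).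

## Main definitions and results

* `GreenbergSelmer.padicCoeffIntegers.continuous_ofPadicInt` — the structure map `ℤ_p → 𝒪` is continuous.
* `GreenbergSelmer.padicCoeffIntegers.cyclotomicCharacter ι : Γ_ℚ →ₜ* 𝒪ˣ` — `ε` pushed into `𝒪ˣ`
  (an abbreviation of `cyclotomicCharacterToUnitsCont ℚ p 𝒪 _`).
* `GreenbergSelmer.selfDualTwistChar ι : Γ_ℚ →ₜ* 𝒪ˣ` — `ε^{1−k/2}` (`k` the weight of `g`).
* `OrdinaryNewformDatum.selfDualRep Δ : FramedGaloisRep ℚ 𝒪 2` — `T_g^† = Δ.ρ ⊗ ε^{1−k/2}`;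
  `selfDualRep_apply`, `coe_selfDualRep_apply`, `det_selfDualRep_apply`, `selfDualRep_eq_of_two`.
* `OrdinaryNewformDatum.selfDualCofreeRep Δ`, `OrdinaryNewformDatum.selfDualCofreeRepOver Δ K` — `A_g^†` as a
  continuous `𝒪`-linear representation of `Γ_ℚ`, resp. `Γ_K`; `selfDualCofreeRep_apply`.

## References

* [Castella2018Erratum] F. Castella, Erratum to "On the `p`-part of the Birch–Swinnerton-Dyer formula for
  multiplicative primes", §2 (p. 2). [CastellaHsieh2018] F. Castella, M.-L. Hsieh, Math. Ann. 370 (2018), §1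
  (p. 1), §7.1 ((7.1)). [Nekovar1992] J. Nekovář, Invent. Math. 107 (1992), §3 (the lattice and its pairing).
* [EmertonPollackWeston2006] §3.1 (the cyclotomic normalisation `A_f = K/𝒪 ⊗ T_f`). [Serre1987Duke] §2.2 (twists).
-/

noncomputable section

open Field Topology CongruenceSubgroup
open Literature.NumberTheory.GaloisRepresentations
open Literature.NumberTheory.EllipticCurves.ModularForms
open scoped MatrixGroups ModularForm

namespace Literature.NumberTheory.EllipticCurves.GreenbergSelmer

variable {M : ℕ} {k : ℤ} {g : CuspForm (Gamma0 M) k} {p : ℕ} [Fact p.Prime]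
  (ι : coeffField g →+* PadicAlgCl p)

/-! ### The cyclotomic character with values in `𝒪ˣ` -/

/-- **The structure map `ℤ_p → 𝒪 = padicCoeffIntegers ι` is continuous**: composed with the (inducing)
inclusions `𝒪 ⊆ K ⊆ ℚ̄_p` it is `algebraMap ℤ_[p] ℚ̄_p`, which is continuous
(a normed algebra map after the continuous coercion `ℤ_p ⊆ ℚ_p`). [folklore]
[cite: EmertonPollackWeston2006, §3.1 (p. 17, "`𝒪` the ring of integers of `K`")] -/
theorem padicCoeffIntegers.continuous_ofPadicInt : Continuous (padicCoeffIntegers.ofPadicInt ι) := by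
  refine continuous_induced_rng.2 (continuous_induced_rng.2 ?_)
  have h : ((fun x : padicCoeffField ι ↦ (x : PadicAlgCl p)) ∘ (fun x : padicCoeffIntegers ι ↦
      (x : padicCoeffField ι)) ∘ padicCoeffIntegers.ofPadicInt ι) =
      fun x : ℤ_[p] ↦ algebraMap ℤ_[p] (PadicAlgCl p) x := by
    funext x
    simp only [Function.comp_apply, padicCoeffIntegers.coe_ofPadicInt]
    rw [IsScalarTower.algebraMap_apply ℤ_[p] ℚ_[p] (PadicAlgCl p),
      IsScalarTower.algebraMap_apply ℚ_[p] (padicCoeffField ι) (PadicAlgCl p)]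
    rfl
  rw [h]
  have h' : (algebraMap ℤ_[p] (PadicAlgCl p) : ℤ_[p] → PadicAlgCl p) =
      (algebraMap ℚ_[p] (PadicAlgCl p)) ∘ ((↑) : ℤ_[p] → ℚ_[p]) :=
    funext fun x => IsScalarTower.algebraMap_apply ℤ_[p] ℚ_[p] (PadicAlgCl p) x
  rw [h']
  exact (continuous_algebraMap ℚ_[p] (PadicAlgCl p)).comp continuous_subtype_val

/-- The algebra map `ℤ_[p] → 𝒪` (`= ofPadicInt`, `padicCoeffIntegers.algebraMap_padicInt_eq`) is continuous.
[folklore] [cite: EmertonPollackWeston2006, §3.1 (p. 17)] -/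
theorem padicCoeffIntegers.continuous_algebraMap_padicInt :
    Continuous (algebraMap ℤ_[p] (padicCoeffIntegers ι)) := by
  rw [padicCoeffIntegers.algebraMap_padicInt_eq]
  exact padicCoeffIntegers.continuous_ofPadicInt ι

/-- **The `p`-adic cyclotomic character with values in `𝒪ˣ`**, `Γ_ℚ → ℤ_pˣ → 𝒪ˣ`, as a continuous homomorphism:
the tree's `cyclotomicCharacterToUnitsCont ℚ p 𝒪` at `𝒪 = padicCoeffIntegers ι` (continuity of the structure map by
`continuous_algebraMap_padicInt`). [folklore] [cite: CastellaHsieh2018, §7.1 (the pairing `T × T → 𝒪(1)`)] -/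
abbrev padicCoeffIntegers.cyclotomicCharacter : absoluteGaloisGroup ℚ →ₜ* (padicCoeffIntegers ι)ˣ :=
  cyclotomicCharacterToUnitsCont ℚ p (padicCoeffIntegers ι) (padicCoeffIntegers.continuous_algebraMap_padicInt ι)

/-- Values of `padicCoeffIntegers.cyclotomicCharacter` in `𝒪`: the image of `ε(σ) ∈ ℤ_pˣ` under `ℤ_p → 𝒪`.
[folklore] [cite: CastellaHsieh2018, §7.1] -/
theorem padicCoeffIntegers.coe_cyclotomicCharacter_apply (σ : absoluteGaloisGroup ℚ) :
    ((padicCoeffIntegers.cyclotomicCharacter ι σ : (padicCoeffIntegers ι)ˣ) : padicCoeffIntegers ι) =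
      algebraMap ℤ_[p] (padicCoeffIntegers ι) ((GaloisRep.cyclotomicCharacter ℚ p σ : ℤ_[p]ˣ) : ℤ_[p]) :=
  coe_cyclotomicCharacterToUnitsCont_apply ℚ p (padicCoeffIntegers ι) _ σ

/-! ### The self-dual twist of an ordinary newform datum -/

/-- **The twisting character `ε^{1−k/2} : Γ_ℚ →ₜ* 𝒪ˣ`** taking the datum's lattice (`det = ε^{k−1}`) to the self-dual
one (`det = ε`): the integer power `1 − k/2` (`k` = the weight of `g`, even in every use; the exponent is `0` at
`k = 2`) of `padicCoeffIntegers.cyclotomicCharacter ι` in the group `Γ_ℚ →ₜ* 𝒪ˣ`.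
[cite: Castella2018Erratum, §2 (p. 2, "the self-dual Tate twist")] [cite: CastellaHsieh2018, §1 (p. 1, "`V_f(r)` the self-dual Tate twist")] -/
def selfDualTwistChar : absoluteGaloisGroup ℚ →ₜ* (padicCoeffIntegers ι)ˣ :=
  padicCoeffIntegers.cyclotomicCharacter ι ^ (1 - k / 2)

/-- Unfolding `selfDualTwistChar`. [cite: Castella2018Erratum, §2 (p. 2)] -/
theorem selfDualTwistChar_def : selfDualTwistChar ι = padicCoeffIntegers.cyclotomicCharacter ι ^ (1 - k / 2) :=
  rfl

/-- At weight `k = 2` the twisting character is trivial. [cite: Castella2018Erratum, §2 (p. 2)] -/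
theorem selfDualTwistChar_eq_one_of_two (hk : k = 2) : selfDualTwistChar ι = 1 := by
  have h0 : (1 - k / 2 : ℤ) = 0 := by subst hk; decide
  rw [selfDualTwistChar_def, h0, zpow_zero]

namespace OrdinaryNewformDatum

variable {ι} (Δ : OrdinaryNewformDatum g p ι)

/-- **`T_g^† = T_g ⊗ ε^{1−k/2}`, the SELF-DUAL Tate twist of the datum's integral model** (`Γ_ℚ → GL₂(𝒪)`,
`σ ↦ ε(σ)^{1−k/2} · Δ.ρ(σ)`; tree `FramedRep.twist`): the lattice of Castella's erratum §2 / Castella–Hsieh §7.1 /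
Nekovář §3 up to homothety (its determinant is `ε`, `det_selfDualRep_apply`; at `k = 2` it is `Δ.ρ`,
`selfDualRep_eq_of_two`).
[cite: Castella2018Erratum, §2 (p. 2, "Let `V_g` be the self-dual Tate twist … `T_g ⊂ V_g` … [Nek92, § 3]")]
[cite: CastellaHsieh2018, §1 (p. 1) and §7.1 ((7.1))] [cite: Nekovar1992, §3] -/
def selfDualRep : FramedGaloisRep ℚ (padicCoeffIntegers ι) 2 :=
  FramedRep.twist Δ.ρ (selfDualTwistChar ι)

/-- Unfolding `selfDualRep`: `T_g^†(σ) = scalar(ε^{1−k/2}(σ)) · Δ.ρ(σ)`. [cite: Castella2018Erratum, §2 (p. 2)] -/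
theorem selfDualRep_apply (σ : absoluteGaloisGroup ℚ) :
    Δ.selfDualRep σ = FramedRep.scalar (padicCoeffIntegers ι) 2 (selfDualTwistChar ι σ) * Δ.ρ σ :=
  rfl

/-- `T_g^†(σ) = ε^{1−k/2}(σ) • Δ.ρ(σ)` as matrices. [cite: Castella2018Erratum, §2 (p. 2)] -/
theorem coe_selfDualRep_apply (σ : absoluteGaloisGroup ℚ) :
    ((Δ.selfDualRep σ : GL (Fin 2) (padicCoeffIntegers ι)) : Matrix (Fin 2) (Fin 2) (padicCoeffIntegers ι)) =
      ((selfDualTwistChar ι σ : (padicCoeffIntegers ι)ˣ) : padicCoeffIntegers ι) •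
        ((Δ.ρ σ : GL (Fin 2) (padicCoeffIntegers ι)) : Matrix (Fin 2) (Fin 2) (padicCoeffIntegers ι)) :=
  FramedRep.coe_twist_apply Δ.ρ (selfDualTwistChar ι) σ

/-- `det T_g^†(σ) = ε^{1−k/2}(σ)² · det Δ.ρ(σ)` (so `= ε(σ)` once `det Δ.ρ = ε^{k−1}`).
[cite: CastellaHsieh2018, §7.1 ((7.1), `T × T → 𝒪(1)`)] -/
theorem det_selfDualRep_apply (σ : absoluteGaloisGroup ℚ) :
    Matrix.GeneralLinearGroup.det (Δ.selfDualRep σ) =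
      selfDualTwistChar ι σ ^ 2 * Matrix.GeneralLinearGroup.det (Δ.ρ σ) :=
  FramedRep.det_twist_apply Δ.ρ (selfDualTwistChar ι) σ

/-- **At weight `k = 2` the self-dual twist is the datum's own lattice** (`ε^{1−2/2} = 1`, `ρ ⊗ 1 = ρ`): the
weight-2 files of the tree (where `T = T_pE` is self-dual) are unaffected by the twist.
[cite: Castella2018Erratum, §2 (p. 2)] [cite: EmertonPollackWeston2006, §3.1 (p. 17)] -/
theorem selfDualRep_eq_of_two (hk : k = 2) : Δ.selfDualRep = Δ.ρ := by
  rw [selfDualRep, selfDualTwistChar_eq_one_of_two ι hk, FramedRep.twist_one]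

/-! ### `A_g^† = V_g^†/T_g^†` and its restriction to `Γ_K` -/

/-- **`A_g^† = V_g^†/T_g^† = F²/𝒪²`** with the `Γ_ℚ`-action through the self-dual twist `T_g^†`, as a continuous
`𝒪`-linear representation on a discrete module (`cofreeContinuousRep`, open denominators by
`hasOpenDenominators_padicCoeffIntegers`) — the erratum's `A_g`. Companion of `Δ.cofreeRep` (same file family),
which is the UNTWISTED `A_g` of the cyclotomic theory.
[cite: Castella2018Erratum, §2 (p. 2, "`A_g := V_g/T_g`")] [cite: CastellaHsieh2018, §1 (p. 1)] -/
abbrev selfDualCofreeRep :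
    ContinuousRep (absoluteGaloisGroup ℚ) (padicCoeffIntegers ι) (Cofree Δ.selfDualRep (padicCoeffField ι)) :=
  cofreeContinuousRep (padicCoeffField ι) Δ.selfDualRep (hasOpenDenominators_padicCoeffIntegers ι)

/-- Unfolding: `Δ.selfDualCofreeRep σ a = σ • a` (the tree's action on `Cofree Δ.selfDualRep F`).
[cite: Castella2018Erratum, §2 (p. 2)] -/
theorem selfDualCofreeRep_apply (σ : absoluteGaloisGroup ℚ) (a : Cofree Δ.selfDualRep (padicCoeffField ι)) :
    Δ.selfDualCofreeRep σ a = σ • a :=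
  rfl

/-- **`A_g^†|_{Γ_K}`** for a number field `K`: restriction along `absGaloisRestrict ℚ K` — the module whose big
anticyclotomic Selmer dual `XBig κ (Δ.selfDualCofreeRepOver K) 𝔭̄ Σ` is the erratum's `X^Σ_ac(A_g)` (Thm. 2.3).
[cite: Castella2018Erratum, §2 (pp. 2–3, "`M_g := T_g ⊗_𝒪 Λ_𝒪^*` … `X^Σ_ac(A_g) = Sel^Σ_𝔭(K, M_g)^*`")] -/
abbrev selfDualCofreeRepOver (K : Type) [Field K] [NumberField K] :
    ContinuousRep (absoluteGaloisGroup K) (padicCoeffIntegers ι) (Cofree Δ.selfDualRep (padicCoeffField ι)) :=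
  Δ.selfDualCofreeRep.restrict (absGaloisRestrict ℚ K)

end OrdinaryNewformDatum

end Literature.NumberTheory.EllipticCurves.GreenbergSelmer

end
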